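import Literature.AlgebraicGeometry.Motives.HodgeLieWeightOnePlusPairTwinParity
import Literature.AlgebraicGeometry.Motives.HodgeLieEigenspaceNoInvariantForm
import HarnessLib

/-!
# Weight one, plus pair with a twin `𝔰𝔩₂`-ideal and a central imaginary quadratic structure `φ² = −d`: `8 ∣ dim V`
# (the twin / Mumford branch is impossible on the `K`-eigenspaces of a Weil-type structure of rank `≡ 4 (mod 8)`, e.g. rank 12)

Family `hodge`, layer `Literature/AlgebraicGeometry/Motives` (abstract polarizable `ℚ`-Hodge structures; no geometry), namespace
`Literature.AlgebraicGeometry.Motives.HodgeStructure`. THEOREMS ONLY (no definition, no named fact, no `sorry`). Written for the cell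
`pub-hodgeav-hg6` (req-37 (A) Q2b; eng-4 g7, brick B1a of the (3|3) WEIL square, `HOME/jobs/WEIL33-eng4g7/DESIGN.md` §3): the
refinement of the tree's `four_dvd_finrank_of_twin` (`HodgeLieWeightOnePlusPairTwinParity`: the twin branch of
`exists_twin_ideal_of_plusPair` forces `4 ∣ dim V`) in the presence of a Hodge endomorphism `φ` with `φ² = −d`, `ψ`-skew
(`K = ℚ(φ)` imaginary quadratic acting on `V`, e.g. `End_Hdg(V) = K`): then the twin branch forces **`8 ∣ dim V`**. For the
`K`-Weil structures of rank `12` (abelian SIXFOLDS of Weil type with `End⁰ = K`) the twin branch is therefore impossible — exactly as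
`4 ∣ 10` killed it for fivefolds. HONEST FRAMING: nothing here proves HC / HC_AV / HC_CM; unconditional linear algebra; no step towards a
summit statement.

THE ARGUMENT (Moonen–Zarhin 1999 (2.3) type-III position, read on the `K`-eigenspaces; Jacobson III §8). In the plus-pair position with
`𝔷 = 0` and a twin ideal `W = ⟨h', e', f'⟩ ≅ 𝔰𝔩₂` commuting with `𝔰 = ⟨B₀, C₀, Θ⟩` one has `tr_{V_ℂ}(h'²) = dim V`
(`eight_mul_trace_mul_eq_finrank_mul_killingForm_of_plusPair`, `killingForm_eq_eight_of_twin`). Everything in `𝔥_ℂ` commutes with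
`φ_ℂ`, so `G = h'²`, `B₀`, `C₀`, `Θ` preserve the eigenspaces `W_μ = ker(φ_ℂ − μ)`, `W̄ = ker(φ_ℂ + μ)` (`μ² = −d`) and commute with
the projector `π = (μ + φ_ℂ)/2μ` onto `W_μ` (`CentralEigen.projector_facts`):
* `tr(G|_{W̄}) = tr(G|_{W_μ})` — `G` is `ψ_ℂ`-SELFADJOINT (`h'` is skew) and `ψ_ℂ` puts `W̄` and `W_μ` in duality
  (`CentralEigen.exists_dualityEquiv`): `G|_{W̄}` is the transpose of `G|_{W_μ}` (`CentralEigen.trace_restrict_eigenspace_neg_eq`);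
  hence `tr_V(G π) = tr(G|_{W_μ}) = dim V / 2` (a private lemma `tr_V(G p) = tr_U(G|_U)` for a projector `p` onto `U`);
* `tr_V(G π Θ) = μ₀⁻¹ tr_V(G π [B₀, C₀]) = 0` (cyclicity; `h'` commutes with `C₀`), and `Θ = p₊ − q` with the Hodge projectors
  `p₊ = (1 + Θ)/2`, `q = (1 − Θ)/2`, so `tr_V(G π q) = tr_V(G π)/2 = dim V / 4`;
* `π q` is a projector onto `W_μ⁻ = W_μ ∩ V^{0,1}`, an `⟨h', e', f'⟩`-submodule, so `tr_V(G π q) = tr_{W_μ⁻}(h'²)` is EVEN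
  (`Literature.Algebra.Lie.exists_trace_restrict_mul_self_eq_two_mul_of_sl2Triple`).
Hence `dim V = 8N`: **`eight_dvd_finrank_of_twin_of_quadratic`**.

## References

* [MoonenZarhin1999LowDim] B. Moonen, Yu. Zarhin, Math. Ann. 315 (1999), §2 (2.3) (type III / Mumford position), §3 proof of (3.4).
* [Jacobson1962LieAlgebras] N. Jacobson, *Lie Algebras* (1962), Ch. III §8 (representations of `𝔰𝔩₂`), Ch. X §1.
* [Deligne1982HodgeCycles] P. Deligne, LNM 900 (1982), I §3, §4 p. 30 (`H¹ ⊗ ℂ = ⊕_σ H¹_σ`).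
* [Gordon1997] B. B. Gordon, arXiv:alg-geom/9709030, §6 (proof of Thm. 6.3.3, p. 19: `W′`, `W″` in duality under `ψ`).
-/

noncomputable section

open scoped TensorProduct

namespace Literature.AlgebraicGeometry.Motives

open Module

universe u

namespace HodgeStructure

variable {V : Type u} [AddCommGroup V] [Module ℚ V] [Module.Finite ℚ V] {n : ℤ}

/-! ### §1 Two trace lemmas: `tr_V(G p) = tr_U(G|_U)` for a projector `p` onto `U`; `tr(G|_{W̄}) = tr(G|_W)` for selfadjoint `G` -/

omit [Module.Finite ℚ V] in
/-- **`tr_V(G ∘ p) = tr_U(G|_U)`** for an operator `p` with `p(V) ⊆ U`, `p = 1` on `U` (a projector onto `U`) and `G` preserving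
`U`: `V = U ⊕ ker p`, `G p` is `G` on `U` and `0` on `ker p`. Private plumbing. [folklore] -/
private theorem CentralEigen.trace_mul_eq_trace_restrict {M : Type*} [AddCommGroup M] [Module ℂ M] [Module.Finite ℂ M]
    {U : Submodule ℂ M} {p G : Module.End ℂ M} (hpU : ∀ x, p x ∈ U) (hpid : ∀ u ∈ U, p u = u)
    (hG : Set.MapsTo G U U) : LinearMap.trace ℂ M (G * p) = LinearMap.trace ℂ U (G.restrict hG) := by
  classical
  have hcompl : IsCompl U (LinearMap.ker p) := by
    refine ⟨Submodule.disjoint_def.2 fun x hxU hxK => ?_, codisjoint_iff.2 (Submodule.eq_top_iff'.2 fun x => ?_)⟩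
    · rw [LinearMap.mem_ker] at hxK
      rw [← hpid x hxU, hxK]
    · have hx : x = p x + (x - p x) := by abel
      rw [hx]
      refine Submodule.add_mem_sup (hpU x) ?_
      rw [LinearMap.mem_ker, map_sub, hpid _ (hpU x), sub_self]
  let N : Bool → Submodule ℂ M := fun b => cond b U (LinearMap.ker p)
  have hint : DirectSum.IsInternal N :=
    (DirectSum.isInternal_submodule_iff_isCompl N (i := true) (j := false) (by decide)
      (Set.eq_univ_of_forall fun b => by cases b <;> simp).symm).2 hcompl
  have hU' : Set.MapsTo (G * p) U U := fun u hu => by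
    simp only [SetLike.mem_coe] at hu ⊢
    rw [Module.End.mul_apply, hpid u hu]; exact hG hu
  have hK' : Set.MapsTo (G * p) (LinearMap.ker p) (LinearMap.ker p) := fun x hx => by
    simp only [SetLike.mem_coe, LinearMap.mem_ker] at hx ⊢
    rw [Module.End.mul_apply, hx, map_zero, map_zero]
  have hmaps : ∀ b, Set.MapsTo (G * p) (N b) (N b) := fun b =>
    match b with
    | true => hU'
    | false => hK'
  have hsplit := LinearMap.trace_eq_sum_trace_restrict hint hmaps
  rw [Fintype.sum_bool] at hsplit
  have h1 : LinearMap.trace ℂ (N true) ((G * p).restrict (hmaps true)) = LinearMap.trace ℂ U (G.restrict hG) := by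
    change LinearMap.trace ℂ U ((G * p).restrict hU') = _
    congr 1
    exact LinearMap.ext fun u => Subtype.ext (by
      change (G * p) u = G u
      rw [Module.End.mul_apply, hpid u u.2])
  have h2 : LinearMap.trace ℂ (N false) ((G * p).restrict (hmaps false)) = 0 := by
    change LinearMap.trace ℂ (LinearMap.ker p) ((G * p).restrict hK') = 0
    have h0 : (G * p).restrict hK' = 0 :=
      LinearMap.ext fun x => Subtype.ext (by
        change (G * p) x = 0
        rw [Module.End.mul_apply, LinearMap.mem_ker.1 x.2, map_zero])
    rw [h0, map_zero]
  rw [hsplit, h1, h2, add_zero]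

/-- **`tr(G|_{W̄}) = tr(G|_W)` for a `ψ_ℂ`-selfadjoint operator `G` commuting with `φ_ℂ`** (`φ² = −d`, `ψ`-skew, `μ² = −d`,
`W = ker(φ_ℂ − μ)`, `W̄ = ker(φ_ℂ + μ)`): under the duality `θ : W̄ ≃ W^*` of `CentralEigen.exists_dualityEquiv` the restriction
`G|_{W̄}` is the transpose of `G|_W` (Gordon §6: `W″ ≅ (W′)^*` via `ψ`). [cite: Gordon1997, §6 (proof of Thm. 6.3.3, p. 19)]
[cite: Deligne1982HodgeCycles, §4 (p. 30)] -/
theorem CentralEigen.trace_restrict_eigenspace_neg_eq {H : HodgeStructure V n} (ψ : H.Polarization) {φ : Module.End ℚ V}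
    {d : ℚ} (hd : 0 < d) (hφ2 : φ * φ = -(d • 1)) (hφskew : ∀ v w, ψ.form (φ v) w + ψ.form v (φ w) = 0) {μ : ℂ}
    (hμ : μ ^ 2 = -(d : ℂ)) {G : Module.End ℂ (ℂ ⊗[ℚ] V)} (hGφ : G * φ.baseChange ℂ = φ.baseChange ℂ * G)
    (hGsa : ∀ x y, ψ.form.baseChange ℂ (G x) y = ψ.form.baseChange ℂ x (G y)) :
    LinearMap.trace ℂ (Module.End.eigenspace (φ.baseChange ℂ) (-μ))
        (G.restrict fun x (hx : x ∈ Module.End.eigenspace (φ.baseChange ℂ) (-μ)) =>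
          UnitaryTheta.apply_mem_eigenspace_of_commute hGφ hx) =
      LinearMap.trace ℂ (Module.End.eigenspace (φ.baseChange ℂ) μ)
        (G.restrict fun x (hx : x ∈ Module.End.eigenspace (φ.baseChange ℂ) μ) =>
          UnitaryTheta.apply_mem_eigenspace_of_commute hGφ hx) := by
  obtain ⟨θ, hθapply, -⟩ := CentralEigen.exists_dualityEquiv ψ hd hφ2 hφskew hμ
  set Gν := G.restrict fun x (hx : x ∈ Module.End.eigenspace (φ.baseChange ℂ) (-μ)) =>
    UnitaryTheta.apply_mem_eigenspace_of_commute hGφ hx with hGν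
  set Gμ := G.restrict fun x (hx : x ∈ Module.End.eigenspace (φ.baseChange ℂ) μ) =>
    UnitaryTheta.apply_mem_eigenspace_of_commute hGφ hx with hGμ
  have key : θ.conj Gν = Gμ.dualMap := by
    refine LinearMap.ext fun ξ => LinearMap.ext fun w => ?_
    obtain ⟨w', rfl⟩ := θ.surjective ξ
    rw [LinearEquiv.conj_apply, LinearMap.comp_apply, LinearMap.comp_apply, LinearEquiv.coe_coe, LinearEquiv.coe_coe,
      θ.symm_apply_apply, LinearMap.dualMap_apply, hθapply, hθapply, hGν, hGμ, LinearMap.coe_restrict_apply,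
      LinearMap.coe_restrict_apply, hGsa]
  have h1 : LinearMap.trace ℂ _ (θ.conj Gν) = LinearMap.trace ℂ _ Gν := LinearMap.trace_conj' Gν θ
  rw [key, LinearMap.dualMap_def, LinearMap.trace_transpose'] at h1
  exact h1.symm

/-! ### §2 The twin branch with an imaginary quadratic structure forces `8 ∣ dim V` -/

variable [HodgeTensorFacts.{u, u}]

set_option maxHeartbeats 800000 in
/-- **Plus pair + twin `𝔰𝔩₂`-ideal + a `ψ`-skew Hodge endomorphism `φ` with `φ² = −d` ⟹ `8 ∣ dim_ℚ V`.** Data: the plus pair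
`(B₀, C₀, μ₀)` with its lines and `𝔷 = 0`, the twin ideal `W = ⟨h', e', f'⟩` of `exists_twin_ideal_of_plusPair` /
`exists_sl2Triple_of_twin` (`dim W = 3`, `W` commuting with `C`, `Θ`, `C₀`), and `φ ∈ End_Hdg(V)`, `ψ`-skew, `φ² = −d` (`d > 0`),
`μ² = −d`. Then `tr_V(h'²) = dim V` splits as FOUR equal traces over `W_μ^±`, `W̄^±` (duality `W̄ ≅ W^*` for the selfadjoint
`h'²`; `tr(h'² π Θ) = 0` on `W_μ`), and `tr_{W_μ⁻}(h'²)` is even (`W_μ⁻ = W_μ ∩ V^{0,1}` is an `sl₂`-module): `dim V = 8N`.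
For `dim V = 12` (Weil-type abelian sixfolds with `End⁰ = K`) this kills the twin branch, as `4 ∣ 10` did for fivefolds
(`four_dvd_finrank_of_twin`). [cite: MoonenZarhin1999LowDim, §2 (2.3) and §3 proof of Lemma (3.4)] [cite: Jacobson1962LieAlgebras, Ch. III §8]
[cite: Gordon1997, §6 (proof of Thm. 6.3.3, p. 19)] -/
theorem eight_dvd_finrank_of_twin_of_quadratic (H : HodgeStructure V n) (ψ : H.Polarization) (hn : n = 1)
    (heff : H.IsEffective) {Θ : Module.End ℂ (ℂ ⊗[ℚ] V)}
    (hΘ : ∀ p, ∀ x ∈ H.piece p (n - p), Θ x = ((2 * p - n : ℤ) : ℂ) • x)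
    {B₀ C₀ : Module.End ℂ (ℂ ⊗[ℚ] V)} (hB₀ : B₀ ∈ H.hodgeLieC) (hB₀0 : B₀ ≠ 0)
    (hB₀P : ∀ p ∈ H.piece 1 0, B₀ p = 0) (hB₀im : ∀ v, B₀ v ∈ H.piece 1 0)
    (hC₀ : ∀ v, C₀ v = conj (B₀ (conj v))) {μ₀ : ℂ} (hμ₀ : μ₀ ≠ 0)
    (hBC : ∀ p ∈ H.piece 1 0, B₀ (C₀ p) = μ₀ • p) (hCB : ∀ q ∈ H.piece 0 1, C₀ (B₀ q) = μ₀ • q)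
    (hline : ∀ B ∈ H.hodgeLieC, (∀ p ∈ H.piece 1 0, B p = 0) → (∀ v, B v ∈ H.piece 1 0) → ∃ c : ℂ, B = c • B₀)
    (hline' : ∀ C ∈ H.hodgeLieC, (∀ q ∈ H.piece 0 1, C q = 0) → (∀ v, C v ∈ H.piece 0 1) → ∃ c : ℂ, C = c • C₀)
    (hz : H.hodgeLie ⊓ Subalgebra.toSubmodule H.endAlg = ⊥)
    {W C : Submodule ℂ (Module.End ℂ (ℂ ⊗[ℚ] V))} (hWC : W ⊔ C = H.hodgeLieC) (hW3 : Module.finrank ℂ W = 3)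
    (hcommWC : ∀ w ∈ W, ∀ c ∈ C, w * c = c * w) (hWΘ : ∀ w ∈ W, w * Θ = Θ * w) (hWC₀ : ∀ w ∈ W, w * C₀ = C₀ * w)
    {h' e' f' : Module.End ℂ (ℂ ⊗[ℚ] V)} (hh : h' ∈ W) (he : e' ∈ W) (hf : f' ∈ W)
    (hHE : h' * e' - e' * h' = (2 : ℂ) • e') (hHF : h' * f' - f' * h' = -((2 : ℂ) • f')) (hEF : e' * f' - f' * e' = h')
    (hspan : ∀ w ∈ W, ∃ a b c : ℂ, w = a • h' + b • e' + c • f')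
    {φ : Module.End ℚ V} (hφE : φ ∈ H.endAlg) (hφskew : ∀ v w, ψ.form (φ v) w + ψ.form v (φ w) = 0)
    {d : ℚ} (hd : 0 < d) (hφ2 : φ * φ = -(d • 1)) {μ : ℂ} (hμ : μ ^ 2 = -(d : ℂ)) :
    8 ∣ Module.finrank ℚ V := by
  classical
  letI iC : LieRing (Module.End ℂ (ℂ ⊗[ℚ] V)) := LieRing.ofAssociativeRing
  obtain ⟨-, -, hcomm, -, -, -⟩ := PlusPairTwin.facts H hn heff hΘ hB₀P hB₀im hC₀ hBC hCB
  obtain ⟨𝔏', h𝔏'⟩ := exists_lieSubalgebra_eq_hodgeLieC H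
  have hmem𝔏' : ∀ {x}, x ∈ 𝔏' ↔ x ∈ H.hodgeLieC := fun {x} => by rw [← LieSubalgebra.mem_toSubmodule, h𝔏']
  have hWle : W ≤ H.hodgeLieC := hWC ▸ le_sup_left
  have hh𝔥 : h' ∈ H.hodgeLieC := hWle hh
  have he𝔥 : e' ∈ H.hodgeLieC := hWle he
  have hf𝔥 : f' ∈ H.hodgeLieC := hWle hf
  have hh𝔏 : h' ∈ 𝔏' := hmem𝔏'.2 hh𝔥
  have hkill := eight_mul_trace_mul_eq_finrank_mul_killingForm_of_plusPair H ψ hn heff hΘ hB₀ hB₀0 hB₀P hB₀im hC₀ hμ₀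
    hBC hCB hline hline' hz 𝔏' h𝔏' ⟨h', hh𝔏⟩ ⟨h', hh𝔏⟩
  have h8 : killingForm ℂ 𝔏' ⟨h', hh𝔏⟩ ⟨h', hh𝔏⟩ = 8 :=
    killingForm_eq_eight_of_twin 𝔏' (hWC.trans h𝔏'.symm) hcommWC hh he hf hHE hHF hspan hW3 hh𝔏
  -- `tr_V(h'²) = dim V`
  have htrV : LinearMap.trace ℂ (ℂ ⊗[ℚ] V) (h' * h') = (Module.finrank ℚ V : ℂ) := by
    rw [h8] at hkill
    have h : (8 : ℂ) * LinearMap.trace ℂ (ℂ ⊗[ℚ] V) (h' * h') = 8 * (Module.finrank ℚ V : ℂ) := by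
      rw [mul_comm (8 : ℂ) (Module.finrank ℚ V : ℂ)]; exact hkill
    exact mul_left_cancel₀ (by norm_num : (8 : ℂ) ≠ 0) h
  subst hn
  obtain ⟨hPmem, hQmem, hΘ10, hΘ01, -⟩ := UnitaryTheta.theta_facts H rfl heff hΘ
  obtain ⟨hμ0, -⟩ := UnitaryTheta.conj_eq_neg_of_sq hd hμ
  -- everything in `𝔥_ℂ` commutes with `φ_ℂ`
  set Φ := φ.baseChange ℂ with hΦ
  have hΘ𝔥 : Θ ∈ H.hodgeLieC := H.mem_hodgeLieC_of_forall_piece hΘ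
  have hC₀𝔥 : C₀ ∈ H.hodgeLieC := conjOp_mem_spanC hB₀ hC₀
  have hcφ : ∀ {Y}, Y ∈ H.hodgeLieC → Y * Φ = Φ * Y := fun {Y} hY => H.commute_baseChange_of_mem_hodgeLieC hY ⟨φ, hφE⟩
  have hhφ := hcφ hh𝔥
  have heφ := hcφ he𝔥
  have hfφ := hcφ hf𝔥
  have hΘφ := hcφ hΘ𝔥
  have hB₀φ := hcφ hB₀
  have hC₀φ := hcφ hC₀𝔥
  set G : Module.End ℂ (ℂ ⊗[ℚ] V) := h' * h' with hGdef
  have hGφ : G * Φ = Φ * G := by rw [hGdef, mul_assoc, hhφ, ← mul_assoc, hhφ, mul_assoc]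
  have hGΘ : G * Θ = Θ * G := by rw [hGdef, mul_assoc, hWΘ h' hh, ← mul_assoc, hWΘ h' hh, mul_assoc]
  have hGC₀ : G * C₀ = C₀ * G := by rw [hGdef, mul_assoc, hWC₀ h' hh, ← mul_assoc, hWC₀ h' hh, mul_assoc]
  -- the projector `π` onto `W_μ` along `W̄`
  obtain ⟨hπmem, hπid, hπneg⟩ := CentralEigen.projector_facts (V := V) hφ2 hμ hμ0
  set π : Module.End ℂ (ℂ ⊗[ℚ] V) := (2 * μ)⁻¹ • (μ • (1 : Module.End ℂ (ℂ ⊗[ℚ] V)) + Φ) with hπdef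
  have hπcomm : ∀ {Y : Module.End ℂ (ℂ ⊗[ℚ] V)}, Y * Φ = Φ * Y → Y * π = π * Y := fun {Y} hY => by
    rw [hπdef, mul_smul_comm, smul_mul_assoc, mul_add, add_mul, mul_smul_comm, smul_mul_assoc, mul_one, one_mul, hY]
  have hπzero : ∀ w' ∈ Module.End.eigenspace Φ (-μ), π w' = 0 := fun w' hw' => by
    rw [Module.End.mem_eigenspace_iff] at hw'
    rw [hπdef, LinearMap.smul_apply, LinearMap.add_apply, LinearMap.smul_apply, Module.End.one_apply, hw', neg_smul,
      add_neg_cancel, smul_zero]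
  -- (1) `tr_V(G π) = tr(G|_{W_μ})`, `tr_V(G (1 − π)) = tr(G|_{W̄})`, and the two restricted traces agree
  have hGμ : Set.MapsTo G (Module.End.eigenspace Φ μ) (Module.End.eigenspace Φ μ) := fun x hx =>
    UnitaryTheta.apply_mem_eigenspace_of_commute hGφ hx
  have hGν : Set.MapsTo G (Module.End.eigenspace Φ (-μ)) (Module.End.eigenspace Φ (-μ)) := fun x hx =>
    UnitaryTheta.apply_mem_eigenspace_of_commute hGφ hx
  have htrπ : LinearMap.trace ℂ _ (G * π) = LinearMap.trace ℂ _ (G.restrict hGμ) :=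
    CentralEigen.trace_mul_eq_trace_restrict hπmem hπid hGμ
  have htr1π : LinearMap.trace ℂ _ (G * (1 - π)) = LinearMap.trace ℂ _ (G.restrict hGν) :=
    CentralEigen.trace_mul_eq_trace_restrict (fun x => by rw [LinearMap.sub_apply, Module.End.one_apply]; exact hπneg x)
      (fun w' hw' => by rw [LinearMap.sub_apply, Module.End.one_apply, hπzero w' hw', sub_zero]) hGν
  have hskew : ∀ x y, ψ.form.baseChange ℂ (h' x) y = -ψ.form.baseChange ℂ x (h' y) := fun x y =>
    formBaseChange_skew_of_mem_hodgeLieC ψ hh𝔥 x y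
  have hGsa : ∀ x y, ψ.form.baseChange ℂ (G x) y = ψ.form.baseChange ℂ x (G y) := fun x y => by
    rw [hGdef, Module.End.mul_apply, Module.End.mul_apply, hskew, hskew, neg_neg]
  have hdual : LinearMap.trace ℂ _ (G.restrict hGν) = LinearMap.trace ℂ _ (G.restrict hGμ) :=
    CentralEigen.trace_restrict_eigenspace_neg_eq ψ hd hφ2 hφskew hμ hGφ hGsa
  have htrGπ : (2 : ℂ) * LinearMap.trace ℂ (ℂ ⊗[ℚ] V) (G * π) = (Module.finrank ℚ V : ℂ) := by
    have hsum : G = G * π + G * (1 - π) := by rw [mul_sub, mul_one, add_sub_cancel]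
    rw [← htrV, two_mul]
    nth_rewrite 3 [hsum]
    rw [map_add, htrπ, htr1π, hdual]
  -- (2) `tr_V(G π Θ) = 0`
  have htr0 : LinearMap.trace ℂ (ℂ ⊗[ℚ] V) (G * π * Θ) = 0 := by
    have hΘeq : Θ = μ₀⁻¹ • (B₀ * C₀ - C₀ * B₀) := by rw [hcomm, smul_smul, inv_mul_cancel₀ hμ₀, one_smul]
    have hπC₀ : C₀ * π = π * C₀ := hπcomm hC₀φ
    have h1 : LinearMap.trace ℂ (ℂ ⊗[ℚ] V) (G * π * (B₀ * C₀)) = LinearMap.trace ℂ (ℂ ⊗[ℚ] V) (C₀ * (G * π * B₀)) := by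
      rw [← mul_assoc, LinearMap.trace_mul_comm]
    have h2 : C₀ * (G * π * B₀) = G * π * (C₀ * B₀) := by
      calc C₀ * (G * π * B₀) = (C₀ * G) * π * B₀ := by noncomm_ring
        _ = (G * C₀) * π * B₀ := by rw [hGC₀]
        _ = G * (C₀ * π) * B₀ := by noncomm_ring
        _ = G * (π * C₀) * B₀ := by rw [hπC₀]
        _ = G * π * (C₀ * B₀) := by noncomm_ring
    rw [hΘeq, mul_smul_comm, map_smul, mul_sub, map_sub, h1, h2, sub_self, smul_zero]
  -- (3) the Hodge projector `q = (1 − Θ)/2` onto `V^{0,1}`; `tr_V(G π q) = tr_V(G π)/2`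
  set q : Module.End ℂ (ℂ ⊗[ℚ] V) := (2 : ℂ)⁻¹ • (1 - Θ) with hqdef
  have hqapply : ∀ v, q v = (2 : ℂ)⁻¹ • (v - Θ v) := fun v => by
    rw [hqdef, LinearMap.smul_apply, LinearMap.sub_apply, Module.End.one_apply]
  have htrq : (2 : ℂ) * LinearMap.trace ℂ (ℂ ⊗[ℚ] V) (G * π * q) = LinearMap.trace ℂ (ℂ ⊗[ℚ] V) (G * π) := by
    have hq2 : (2 : ℂ) • (G * π * q) = G * π - G * π * Θ := by
      rw [hqdef, mul_smul_comm, smul_smul, mul_inv_cancel₀ (two_ne_zero' ℂ), one_smul, mul_sub, mul_one]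
    have h := congrArg (LinearMap.trace ℂ (ℂ ⊗[ℚ] V)) hq2
    rw [map_smul, map_sub, htr0, sub_zero, smul_eq_mul] at h
    exact h
  -- (4) `π q` is a projector onto `W_μ⁻ = W_μ ⊓ V^{0,1}`, an `sl₂`-submodule: `tr_V(G π q) = tr_{W_μ⁻}(h'²) = 2N`
  set U : Submodule ℂ (ℂ ⊗[ℚ] V) := Module.End.eigenspace Φ μ ⊓ H.piece 0 1 with hUdef
  have hΘq : ∀ v, Θ (q v) = -q v := fun v => by
    have hqQ : q v ∈ H.piece 0 1 := by rw [hqapply]; exact hQmem v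
    exact hΘ01 _ hqQ
  have hpU : ∀ x, (π * q) x ∈ U := fun x => by
    rw [Module.End.mul_apply]
    refine Submodule.mem_inf.2 ⟨hπmem _, ?_⟩
    have hmem := hQmem (π (q x))
    have hΘπq : Θ (π (q x)) = -π (q x) := by
      rw [← Module.End.mul_apply, hπcomm hΘφ, Module.End.mul_apply, hΘq, map_neg]
    rwa [hΘπq, sub_neg_eq_add, ← two_smul ℂ (π (q x)), smul_smul, inv_mul_cancel₀ (two_ne_zero' ℂ), one_smul] at hmem
  have hpid : ∀ u ∈ U, (π * q) u = u := fun u hu => by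
    obtain ⟨huW, huQ⟩ := Submodule.mem_inf.1 hu
    rw [Module.End.mul_apply, hqapply, hΘ01 u huQ, sub_neg_eq_add, ← two_smul ℂ u, smul_smul,
      inv_mul_cancel₀ (two_ne_zero' ℂ), one_smul, hπid u huW]
  have hpresQ : ∀ Y : Module.End ℂ (ℂ ⊗[ℚ] V), Y * Θ = Θ * Y → ∀ x ∈ H.piece 0 1, Y x ∈ H.piece 0 1 := by
    intro Y hY x hx
    have h1 : Θ (Y x) = -Y x := by rw [← Module.End.mul_apply, ← hY, Module.End.mul_apply, hΘ01 x hx, map_neg]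
    have h2 := hQmem (Y x)
    rwa [h1, sub_neg_eq_add, ← two_smul ℂ (Y x), smul_smul, inv_mul_cancel₀ (two_ne_zero' ℂ), one_smul] at h2
  have hUst : ∀ {Y : Module.End ℂ (ℂ ⊗[ℚ] V)}, Y * Φ = Φ * Y → Y * Θ = Θ * Y → Set.MapsTo Y U U :=
    fun {Y} hYφ hYΘ x hx => by
      obtain ⟨hxW, hxQ⟩ := Submodule.mem_inf.1 hx
      exact Submodule.mem_inf.2 ⟨UnitaryTheta.apply_mem_eigenspace_of_commute hYφ hxW, hpresQ Y hYΘ x hxQ⟩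
  have hhU := hUst hhφ (hWΘ h' hh)
  have heU := hUst heφ (hWΘ e' he)
  have hfU := hUst hfφ (hWΘ f' hf)
  have hGU := hUst hGφ hGΘ
  obtain ⟨N, hN⟩ := Literature.Algebra.Lie.exists_trace_restrict_mul_self_eq_two_mul_of_sl2Triple hHE hHF hEF hhU heU hfU
  have htrU : LinearMap.trace ℂ (ℂ ⊗[ℚ] V) (G * (π * q)) = 2 * N := by
    rw [CentralEigen.trace_mul_eq_trace_restrict hpU hpid hGU, ← hN]
    congr 1
  -- (5) combine: `dim V = 2 tr(Gπ) = 4 tr(Gπq) = 8N`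
  have hfin : (Module.finrank ℚ V : ℂ) = 8 * N := by
    rw [← htrGπ, ← htrq, mul_assoc G π q, htrU]; ring
  have hd8 : (Module.finrank ℚ V : ℤ) = 8 * N := by exact_mod_cast hfin
  exact Int.natCast_dvd_natCast.1 ⟨N, hd8⟩

end HodgeStructure

end Literature.AlgebraicGeometry.Motives

end
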